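import Summits.RiemannHypothesis.RiemannHypothesis.Theorems.TiltedLandingLaw421R3QuadW
import Summits.RiemannHypothesis.RiemannHypothesis.Theorems.TiltedLandingLaw421R3ClusterStep
import Summits.RiemannHypothesis.RiemannHypothesis.Theorems.TiltedLandingLaw421R3BotQ

/-!
# The NESTED SUCCESSOR LEMMA for `stub_restSuccBotQ`

SUPPORT module for crux `TiltedLandingLaw421` (stmt-RiemannHypothesis-24774), `--supports … --as helper` only.

★ `stTrkDQ_succ_of_nested`: Given a `StTrkDQ` state `v` at level `j` and a non-real zero `w` of `f^{(j+1)}`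
with `NestedStep v w` (i.e., `w` lies in the closed Jensen disc of `v`), then `w` satisfies `StTrkDQ` at level `j+1`.

This is BRANCH 1 of `stub_restSuccBotQ`: the case where some non-real zero of `f^{(j+1)}` is nested under a
band state. The nested successor inherits band membership via `band_of_hang` (the Markov step).

Hypotheses:
- `hE : EngineHyps5 2 η f x₀ s hmax R Hs B` — the frame is legal
- `hv : StTrkDQ η f x₀ s hmax R Hs B j v` — `v` is a band state at level `j`
- `hw0 : iteratedDeriv (j+1) f w = 0` — `w` is a zero of `f^{(j+1)}`
- `hwim : 0 < w.im` — `w` is in the upper half-plane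
- `hn : NestedStep v w` — `w` lies in the closed Jensen disc of `v`

The hypothesis `w.im ≤ Hs` is DERIVED from `NestedStep` via `nlinarith` (not a separate argument).

Cut from g15 deposit `pub/rh-split/rh-law421/alpha/StubRestSuccBotQ-g15.lean` c0d06803 per SUMMON 074506Z.
Typed ≠ proved; RH is NOT proved; 24774 OPEN.
-/

set_option linter.dupNamespace false

namespace RhW08.SuccB

open Complex Set
open RhIdea6.G17.W07C7 RhIdea6.G17.W07C7.Rev6 RhIdea6.G18.W07C8.Law421BirthS RhIdea6.G19.W07C11.Seam
open RhIdea6.G20.W07C12.Frac RhIdea6.G20.W07C12.StColP RhW07.C12.FieldSplit RhIdea6.G21.W07C13.TentMax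
open RhW07.C14.TwoSided RhW07.C14.Classes RhW07.C14.Lineage RhW07.C14.Booking
open RhW07.C13.Heredity RhIdea6.G22.W07C15pre.Injection RhW07.E3.Cell RhW07.E3.Lit
open RhW08.Round1 RhW08.StSwap RhW08.Round2 RhW08.QuadW RhW08.SealSwapQ RhW08.SealSwap

/-- ★★ **BRANCH 1: NESTED SUCCESSOR**. Given a `StTrkDQ` state `v` at level `j` and a non-real zero `w` of
`f^{(j+1)}` with `NestedStep v w`, `w` satisfies `StTrkDQ` at level `j+1`.

The key pieces:
1. `f^{(j+1)} ≢ 0`: from `iteratedDeriv_succ_ne_zero_of_zero` (ClusterStep) — `f^{(j)}` is non-constant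
   because it has a non-real zero `v` (real zeros come in conjugate pairs → at least 2 zeros → non-constant).
2. Band membership at `j+1`: from `band_of_hang` (QuadW) — the Markov step for the quadratic window.
3. `w.im ≤ Hs`: from `NestedStep` via `nlinarith` using `v.im ≤ Hs`. -/
theorem stTrkDQ_succ_of_nested {η : ℝ} {f : ℂ → ℂ} {x₀ s hmax R Hs : ℝ} {B j : ℕ} {v w : ℂ}
    (hE : EngineHyps5 2 η f x₀ s hmax R Hs B)
    (hv : StTrkDQ η f x₀ s hmax R Hs B j v)
    (hw0 : iteratedDeriv (j + 1) f w = 0)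
    (hwim : 0 < w.im)
    (hn : NestedStep v w) :
    StTrkDQ η f x₀ s hmax R Hs B (j + 1) w := by
  -- StTrkDQ (j+1) = StColQ' (j+1) requires:
  -- (1) f^{(j+1)} ≢ 0
  -- (2) f^{(j+1)} w = 0
  -- (3) 0 < w.im
  -- (4) band window: (max (|w.re - x₀| - R/2) 0)² + (j+1)·w.im² ≤ (j+1)·Hs²
  -- (5) w.im ≤ Hs
  -- Extract components from hv for the proofs that need them
  have hfjnz : iteratedDeriv j f ≠ 0 := hv.1
  have hfjv : iteratedDeriv j f v = 0 := hv.2.1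
  have hvHs : v.im ≤ Hs := hv.2.2.2.2
  -- Show (1): f^{(j+1)} ≢ 0 from non-constancy
  have hfnz : iteratedDeriv (j + 1) f ≠ 0 :=
    iteratedDeriv_succ_ne_zero_of_zero hE.1 j hfjnz hfjv
  -- Show (4): band membership via band_of_hang (the Markov step)
  have hband := band_of_hang hv hn
  -- Show (5): w.im ≤ Hs from NestedStep + v.im ≤ Hs
  -- NestedStep v w: (w.re - v.re)² + w.im² ≤ v.im²
  -- So w.im² ≤ v.im² ≤ Hs², hence w.im ≤ Hs (both positive)
  have hvim : 0 < v.im := hv.2.2.1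
  have hHs : 0 ≤ Hs := hE.2.2.2.2.2.2.2.1
  have hwHs : w.im ≤ Hs := by
    unfold NestedStep at hn
    have h1 : w.im ^ 2 ≤ v.im ^ 2 := by nlinarith [sq_nonneg (w.re - v.re)]
    have h2 : v.im ^ 2 ≤ Hs ^ 2 := by nlinarith
    have h3 : w.im ^ 2 ≤ Hs ^ 2 := le_trans h1 h2
    have hwpos : 0 ≤ w.im := le_of_lt hwim
    nlinarith [sq_nonneg (w.im - Hs), sq_nonneg (w.im + Hs)]
  -- Assemble the five conjuncts of StColQ' = StTrkDQ
  refine ⟨hfnz, hw0, hwim, ?_, hwHs⟩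
  -- Cast the band membership
  simp only [Nat.cast_add, Nat.cast_one] at hband ⊢
  exact hband

end RhW08.SuccB
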